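import Summits.BirchSwinnertonDyer.BirchSwinnertonDyer.Theorems.UniversalToricDescentResidualSelmerLocal
import Summits.BirchSwinnertonDyer.Rank1Residual.X11b.LocalTrivialityBridge
import HarnessLib

/-!
# Route UniversalToricDescent — unramified ⟹ locally trivial over `K_∞` at a GOOD place `v ∤ p` that is TOTALLY SPLIT in the
# `ℤ_p`-extension (`D_v ≤ Gal(K̄/K_∞)`): `H¹_ur(K_v, E[p^∞]) = 0`

Lead prover bsd-wall-utd-p1 g14 (`--supports` ♭T′ stmt-BirchSwinnertonDyer-26975; line `sigmacongruence` v3 — discharges the hypothesis `hsplit`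
of `…TwistedDualControl.twistedTorsionToH1_mem_selmerAc_of_mem_dualSelmer_strict`). In the ANTICYCLOTOMIC tower of an imaginary quadratic
`K` the primes of `K` inert over `ℚ` split completely, so the tree's `unramKer_le_awayKer` (finitely decomposed places, any reduction,
GV p. 17 «`G_η/I_η` has profinite order prime to `p`») does not cover them; at such a place of GOOD reduction the unramified local
cohomology of `E[p^∞]` over `(K_∞)_w = K_v` vanishes (`E[p^∞]^{I_v} = E[p^∞]` is divisible and `Frob_v − 1` is onto), which the tree
proves as the injectivity of `res : H¹(Ω ⊓ D_v, E[p^∞]) → H¹(I_v, E[p^∞])` for open `Ω ⊇ I_v`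
(`UniversalToricDescentResidualSelmerLocal.resOfLe_inertia_injective_of_isOpen`, here with `Ω = ⊤`).

* §1 `unramifiedKer_le_awayKer_of_decomp_le` — for `H ≥ D_v` (e.g. `H = Gal(K̄/K_∞)`, `v` totally split) and `E` good at `v ∤ p`:
  `unramifiedKer H E[p^∞] v ≤ awayKer H E[p^∞] v`.

HONEST STATUS: helper theorem (local Galois cohomology; good reduction is a hypothesis). THEOREMS ONLY; no definition, no named fact,
no `sorry`. BSD is not advanced by this file.
References: [GreenbergLNM1716] §3 Lemma 3.3 (p. 87), §2 pp. 69–72; [GreenbergVatsal2000] §2 p. 17.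
-/

set_option autoImplicit false
-- `…BirchSwinnertonDyer.BirchSwinnertonDyer.Theorems…` is the problem's mandated namespace (D-0017).
set_option linter.dupNamespace false

noncomputable section
open scoped Classical

namespace Summit.BirchSwinnertonDyer.BirchSwinnertonDyer.Theorems.UniversalToricDescentTwistedDescent

open NumberField IsDedekindDomain Field WeierstrassCurve
  Literature.NumberTheory.EllipticCurves Literature.NumberTheory.GaloisRepresentations
  Literature.NumberTheory.EllipticCurves.GreenbergSelmer Literature.NumberTheory.EllipticCurves.GreenbergVatsal2000
  Summit.BirchSwinnertonDyer.BirchSwinnertonDyer.Theorems.UniversalToricDescentResidualSelmerLocal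

variable {K : Type} [Field K] [NumberField K] (E : WeierstrassCurve K) [E.IsElliptic] (p : ℕ) [Fact p.Prime]

/-- **Unramified ⟹ locally trivial at a good place totally split in `K̄^H`.** Let `v ∤ p` be a finite place of good reduction and
`H ≤ Γ_K` a subgroup containing the decomposition group `D_v` (so the place of `L = K̄^H` above `v` has completion `K_v`). Then a
class of `H¹(H, E[p^∞])` that dies on `H ⊓ I_v` dies on `H ⊓ D_v = D_v`: its restriction to `D_v = ⊤ ⊓ D_v` dies on the inertia
group `I_{𝔓₀} = I_v`, and `res : H¹(⊤ ⊓ D_v, E[p^∞]) → H¹(I_{𝔓₀}, E[p^∞])` is injective (`H¹_ur(K_v, E[p^∞]) = 0` at good `v ∤ p`).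
[cite: GreenbergLNM1716, §3 Lemma 3.3 (p. 87)] [cite: GreenbergVatsal2000, §2 p. 17] -/
theorem unramifiedKer_le_awayKer_of_decomp_le {v : HeightOneSpectrum (𝓞 K)} (hpv : ((p : ℕ) : 𝓞 K) ∉ v.asIdeal)
    (hv : E.HasGoodReductionAt v) {H : Subgroup (absoluteGaloisGroup K)} (hD : decomp v ≤ H) :
    unramifiedKer H (E.geomPrimaryTorsion p) v ≤ awayKer H (E.geomPrimaryTorsion p) v := by
  intro c hc
  set A := E.geomPrimaryTorsion p with hA
  set I₀ := (adicCompletionPrime K v).inertia (absoluteGaloisGroup K) with hI₀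
  have hIv : I₀ = inertia v := by rw [hI₀, inertia_adicCompletionPrime_eq_map_absInertia]; rfl
  have hID : I₀ ≤ decomp v := hIv ▸ inertia_le_decomp v
  have hIH : I₀ ≤ H := hID.trans hD
  -- the restriction of `c` to `⊤ ⊓ D_v ≤ H`
  have hTD : (⊤ : Subgroup (absoluteGaloisGroup K)) ⊓ decomp v ≤ H := inf_le_right.trans hD
  set c₁ := resOfLe A hTD c with hc₁
  -- it dies on `I₀`: same as `c` restricted to `I₀ ≤ H`, which vanishes because `c` is unramified
  have hle₁ : I₀ ≤ (⊤ : Subgroup (absoluteGaloisGroup K)) ⊓ decomp v := le_inf le_top hID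
  have hres : resOfLe A hle₁ c₁ = 0 := by
    have hcomp : resOfLe A hle₁ c₁ = resOfLe A hIH c := by
      rw [hc₁, ← AddMonoidHom.comp_apply, Literature.NumberTheory.EllipticCurves.resOfLe_comp_holds]
    rw [hcomp]
    -- compare with the map defining `unramifiedKer` (same range `I_v = H ⊓ I_v` in `Γ_K`)
    rw [GreenbergVatsal2000.unramifiedKer, AddMonoidHom.mem_ker] at hc
    rw [Literature.NumberTheory.EllipticCurves.resOfLe]
    refine (Summit.BirchSwinnertonDyer.Rank1Residual.X11b.LocBridge.resH1Hom_eq_zero_iff_of_range_eq (subgroupInclusion hIH) (AddMonoidHom.id A) (fun _ _ ↦ rfl)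
      Function.bijective_id (inertiaInToH H v) (AddMonoidHom.id A) (fun _ _ ↦ rfl) Function.bijective_id ?_ c).2 hc
    ext x
    constructor
    · rintro ⟨y, rfl⟩
      have hyI : ((y : absoluteGaloisGroup K)) ∈ inertia v := hIv ▸ y.2
      have hyD : (y : absoluteGaloisGroup K) ∈ decomp v := hID y.2
      exact ⟨⟨⟨y, hyD⟩, (mem_inertiaIn_iff H v _).2 ⟨hIH y.2, hyI⟩⟩, rfl⟩
    · rintro ⟨y, rfl⟩
      obtain ⟨-, hyI⟩ := (mem_inertiaIn_iff H v y.1).1 y.2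
      exact ⟨⟨((y.1 : decomp (K := K) v) : absoluteGaloisGroup K), hIv ▸ hyI⟩, rfl⟩
  -- injectivity of restriction to inertia at a good place (`Ω = ⊤`)
  have hinj := resOfLe_inertia_injective_of_isOpen E p (v := v) hpv hv (Ω := ⊤) isOpen_univ le_top
  have hc₁0 : c₁ = 0 := (injective_iff_map_eq_zero _).mp hinj c₁ hres
  -- conclude on `H ⊓ D_v ≤ ⊤ ⊓ D_v`
  have hHD : H ⊓ decomp v ≤ (⊤ : Subgroup (absoluteGaloisGroup K)) ⊓ decomp v := inf_le_inf_right _ le_top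
  rw [awayKer, AddMonoidHom.mem_ker]
  have hcomp : resOfLe A (inf_le_left : H ⊓ decomp v ≤ H) c = resOfLe A hHD c₁ := by
    rw [hc₁, ← AddMonoidHom.comp_apply, Literature.NumberTheory.EllipticCurves.resOfLe_comp_holds]
  rw [hcomp, hc₁0, map_zero]

/-- **The `ℤ_p`-extension form**: for `H = Gal(K̄/K_∞) = ker κ`, a good place `v ∤ p` TOTALLY SPLIT in `K_∞` (`D_v ≤ ker κ`):
`unramifiedKer (ker κ) E[p^∞] v ≤ awayKer (ker κ) E[p^∞] v` — the hypothesis `hsplit` of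
`twistedTorsionToH1_mem_selmerAc_of_mem_dualSelmer_strict`. [cite: GreenbergVatsal2000, §2 p. 17] -/
theorem unramifiedKer_le_awayKer_kerSubgroup_of_decomp_le (κ : ZpExtension K p) {v : HeightOneSpectrum (𝓞 K)}
    (hpv : ((p : ℕ) : 𝓞 K) ∉ v.asIdeal) (hv : E.HasGoodReductionAt v) (hD : decomp v ≤ κ.kerSubgroup) :
    unramifiedKer κ.kerSubgroup (E.geomPrimaryTorsion p) v ≤ awayKer κ.kerSubgroup (E.geomPrimaryTorsion p) v :=
  unramifiedKer_le_awayKer_of_decomp_le E p hpv hv hD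

end Summit.BirchSwinnertonDyer.BirchSwinnertonDyer.Theorems.UniversalToricDescentTwistedDescent

end
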